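import Summits.KontsevichZagierPeriods.KontsevichZagierPeriods.Theorems.SoloInformedKZPOneK
import HarnessLib
import HarnessLib.Audit

/-!
# SoloInformed — projective charts for arbitrary representations; the `K`-rational class of dimension 1 without boundedness

Solo programme `solo-KontsevichZagierPeriods-informed`, session s112, file 18.

1. **A class-free compactification move** (`soloInformed_exists_chartReps`, any dimension `n`):
   every integral representation `r = [σ, f]` differs by Kontsevich–Zagier relations from the sum
   over `T ⊆ {1,…,n}` of the `2ⁿ` CHART representations
   `[pieceDom T σ, v ↦ f(inv_T v)·|det D inv_T(v)|]`, whose domains lie in `[-1,1]ⁿ` — Viu-Sos'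
   compactification [Viu-Sos 2021, Thm. 2.1], which the tree states for KZ's rational shape
   (`KZ.exists_sub_sum_bounded_mem_relations`), here for an ARBITRARY representation with the
   chart integrands made explicit (cut along the outer regions, rule (1); change variables by the
   involutions `inv T`, rule (2); absolute convergence by the Jacobian formula).
2. In dimension `1` the charts preserve the class `SoloInformedIsKRationalOne` (integrand `P/Q`,
   `P, Q ∈ K[X]`, `K` = real algebraic numbers, `Q ≠ 0` on the domain): under `y = 1/v`,
   `P(y)/Q(y)·v⁻² = P^*(v)/(Q^*(v) v²)` with the reflected polynomials `P^* = reflect N P`,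
   `Q^* = reflect N Q` (`soloInformed_isKRationalOne_chart`).
3. **Theorem KZP(1, real algebraic coefficients)** without any boundedness hypothesis
   (`soloInformed_segSpan_of_isKRationalOne`, `soloInformed_kzp_isKRationalOne`,
   `soloInformed_sum_zsmul_of_mem_relations_K'`, `soloInformed_sum_constMul_of_mem_relations_K'`):
   every `r` of dimension `1` in the class lies in the span of points and segments; equal values ⇒
   KZ-equivalent (within the class, which contains all rational representations of dimension `1`);
   vanishing `ℤ`- or `K`-linear combinations of values are relations.

References: J. Viu-Sos, *A semi-canonical reduction for periods of Kontsevich–Zagier* (2021),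
Thm. 2.1; M. Kontsevich, D. Zagier, *Periods* (2001), §1.1–1.2.
-/

noncomputable section

open scoped BigOperators Polynomial

namespace Summit.KontsevichZagierPeriods.KontsevichZagierPeriods.Theorems

open Set MeasureTheory
open Literature.ModelTheory.ExponentialFields
open Literature.NumberTheory.Transcendental Literature.NumberTheory.Transcendental.KZ
open PeriodCompactify

/-- **Projective charts for an arbitrary representation** (Viu-Sos' compactification at the level
of moves, class-free): `[σ, f] ≡ Σ_T [pieceDom T σ, f ∘ inv_T · |det D inv_T|]` modulo relations, all
chart domains bounded. [Viu-Sos 2021, Thm. 2.1; tree: `KZ.exists_sub_sum_bounded_mem_relations`] -/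
theorem soloInformed_exists_chartReps {n : ℕ} (r : IntegralRep n) :
    ∃ R : Finset (Fin n) → IntegralRep n,
      (∀ T, (R T).domain = pieceDom T r.domain ∧
        ((R T).integrand = fun v => r.integrand (inv T v) * |(invDeriv T v).det|) ∧
        Bornology.IsBounded (R T).domain) ∧
      of r - ∑ T, of (R T) ∈ relations := by
  classical
  have hσ := r.isSemialgebraic_domain
  have hD : ∀ T : Finset (Fin n), IsSemialgebraic ℚ (pieceDom T r.domain) := fun T =>
    isSemialgebraic_pieceDom T hσ
  have hjac : ∀ T : Finset (Fin n), IsSemialgebraicFunOn ℚ (pieceDom T r.domain)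
      (fun v => |(invDeriv T v).det|) := fun T => by
    refine (isSemialgebraicFunOn_aeval_div_aeval (hD T) (1 : MvPolynomial (Fin n) ℚ)
      (∏ i ∈ T, MvPolynomial.X i ^ 2) fun v hv => ?_).congr fun v hv => ?_
    · rw [aeval_prod_X_sq]
      exact prod_pow_ne_zero T fun i hi => ne_zero_of_mem_inner T hv.1 hi
    · show (MvPolynomial.aeval v (1 : MvPolynomial (Fin n) ℚ) : ℝ) /
          MvPolynomial.aeval v (∏ i ∈ T, MvPolynomial.X i ^ 2 : MvPolynomial (Fin n) ℚ) =
          |(invDeriv T v).det|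
      rw [abs_det_invDeriv, map_one, aeval_prod_X_sq, one_div, ← Finset.prod_inv_distrib]
  have hfun : ∀ T : Finset (Fin n), IsSemialgebraicFunOn ℚ (pieceDom T r.domain)
      (fun v => r.integrand (inv T v) * |(invDeriv T v).det|) := fun T =>
    (IsSemialgebraicFunOn.mul_holds
      (IsSemialgebraicFunOn.comp_isSemialgebraicMapOn_holds r.isSemialgebraicFunOn_integrand
        (isSemialgebraicMapOn_inv_pieceDom T hσ) fun v hv => hv.2) (hjac T)).congr
      fun _ _ => rfl
  have hint : ∀ T : Finset (Fin n), IntegrableOn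
      (fun v => r.integrand (inv T v) * |(invDeriv T v).det|) (pieceDom T r.domain) := fun T => by
    have h := (integrableOn_image_iff_integrableOn_abs_det_fderiv_smul volume
      (measurableSet_pieceDom T hσ) (hasFDerivWithinAt_inv_pieceDom T) (injOn_inv_pieceDom T)
      r.integrand).1 (by
        rw [image_inv_pieceDom]
        exact r.integrableOn.mono_set inter_subset_left)
    refine h.congr_fun (fun v hv => ?_) (measurableSet_pieceDom T hσ)
    show |(invDeriv T v).det| • r.integrand (inv T v) = _
    rw [smul_eq_mul, mul_comm]
  set R : Finset (Fin n) → IntegralRep n := fun T => ⟨_, _, hD T, hfun T, hint T⟩ with hR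
  refine ⟨R, fun T => ⟨rfl, rfl, isBounded_pieceDom T⟩, ?_⟩
  -- the traces of `r` on the outer regions (rule (1): the complement of their union is null)
  have hS : ∀ T, IsSemialgebraic ℚ (r.domain ∩ outer T) := fun T =>
    hσ.inter (isSemialgebraic_outer T)
  set S : Finset (Fin n) → IntegralRep n := fun T => r.restrict _ (hS T) inter_subset_left with hS'
  have e1 : of r - ∑ T, of (S T) ∈ relations := by
    refine of_sub_sum_of_mem_relations Finset.univ r S (fun T _ => ?_) (fun T _ _ _ => rfl) ?_ ?_
    · rw [show (S T).domain \ r.domain = ∅ from sdiff_eq_empty.mpr inter_subset_left, measure_empty]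
    · refine measure_mono_null (fun x hx => ?_) volume_compl_iUnion_outer
      intro hx'
      obtain ⟨T, hT⟩ := mem_iUnion.1 hx'
      exact hx.2 (mem_biUnion (Finset.mem_univ T) ⟨hx.1, hT⟩)
    · intro T hT T' hT' hne
      rw [show (S T).domain ∩ (S T').domain = ∅ from
        Set.disjoint_iff_inter_eq_empty.mp (pairwiseDisjoint_outer r.domain hT hT' hne),
        measure_empty]
  -- each chart is a change-of-variables move (rule (2))
  have e2 : ∀ T, of (R T) - of (S T) ∈ changeOfVariablesRel := fun T =>
    ⟨n, R T, S T, inv T, invDeriv T, isSemialgebraicMapOn_inv_pieceDom T hσ,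
      hasFDerivWithinAt_inv_pieceDom T, injOn_inv_pieceDom T, (image_inv_pieceDom T).symm,
      fun v hv => rfl, rfl⟩
  have e3 := sum_sub_sum_mem_relations Finset.univ _ _ fun T _ =>
    changeOfVariablesRel_subset_relations (e2 T)
  have : of r - ∑ T, of (R T) = (of r - ∑ T, of (S T)) - (∑ T, of (R T) - ∑ T, of (S T)) := by
    abel
  rw [this]
  exact relations.sub_mem e1 e3

/-- Reflection identity over `K`: for `y ≠ 0`, `F(y) · ... `; precisely
`(reflect N F)(y⁻¹) * y ^ N = F(y)` read through `algebraMap K ℝ` (`natDegree F ≤ N`). -/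
theorem soloInformed_aeval_reflect_K (F : (algebraicClosure ℚ ℝ)[X]) {N : ℕ} (hF : F.natDegree ≤ N)
    {y : ℝ} (hy : y ≠ 0) :
    (Polynomial.aeval y⁻¹ (Polynomial.reflect N F) : ℝ) * y ^ N = Polynomial.aeval y F := by
  haveI := invertibleOfNonzero hy
  have h := Polynomial.eval₂_reflect_mul_pow (algebraMap (algebraicClosure ℚ ℝ) ℝ) y N F hF
  rw [invOf_eq_inv] at h
  rw [Polynomial.aeval_def, Polynomial.aeval_def]
  exact h

/-- **The charts preserve the `K`-rational class in dimension `1`.** -/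
theorem soloInformed_isKRationalOne_chart (r : IntegralRep 1) (hr : SoloInformedIsKRationalOne r)
    (T : Finset (Fin 1)) (R : IntegralRep 1) (hdom : R.domain = pieceDom T r.domain)
    (hint : R.integrand = fun v => r.integrand (inv T v) * |(invDeriv T v).det|) :
    SoloInformedIsKRationalOne R := by
  classical
  obtain ⟨P, Q, hq, hpq⟩ := hr
  have hT : T = ∅ ∨ T = Finset.univ := by
    by_cases h0 : (0 : Fin 1) ∈ T
    · exact Or.inr (Finset.eq_univ_iff_forall.2 fun i => by rw [Fin.fin_one_eq_zero i]; exact h0)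
    · exact Or.inl (Finset.eq_empty_iff_forall_notMem.2 fun i hi =>
        h0 (by rw [Fin.fin_one_eq_zero i] at hi; exact hi))
  rcases hT with rfl | rfl
  · -- `T = ∅`: the identity chart
    have hinv : ∀ v : Fin 1 → ℝ, inv (∅ : Finset (Fin 1)) v = v := fun v =>
      funext fun i => inv_apply_of_not_mem ∅ (Finset.notMem_empty i) v
    have hdet : ∀ v : Fin 1 → ℝ, |(invDeriv (∅ : Finset (Fin 1)) v).det| = 1 := fun v => by
      rw [abs_det_invDeriv, Finset.prod_empty]
    have hsub : R.domain ⊆ r.domain := fun v hv => by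
      rw [hdom] at hv
      have h := hv.2
      rwa [mem_preimage, hinv] at h
    refine ⟨P, Q, fun x hx => hq x (hsub hx), fun x hx => ?_⟩
    rw [hint]
    show r.integrand (inv ∅ x) * |(invDeriv ∅ x).det| = _
    rw [hinv, hdet, mul_one]
    exact hpq (hsub hx)
  · -- `T = {0}`: the inversion chart `y = 1/v`
    have hinv : ∀ v : Fin 1 → ℝ, inv (Finset.univ : Finset (Fin 1)) v 0 = (v 0)⁻¹ := fun v =>
      inv_apply_of_mem _ (Finset.mem_univ _) v
    have hdet : ∀ v : Fin 1 → ℝ, |(invDeriv (Finset.univ : Finset (Fin 1)) v).det| =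
        ((v 0) ^ 2)⁻¹ := fun v => by
      rw [abs_det_invDeriv, Fin.prod_univ_one]
    set N := max P.natDegree Q.natDegree with hN
    have hmem : ∀ v ∈ R.domain, v 0 ≠ 0 ∧ inv Finset.univ v ∈ r.domain := fun v hv => by
      rw [hdom] at hv
      exact ⟨ne_zero_of_mem_inner _ hv.1 (Finset.mem_univ _), hv.2⟩
    refine ⟨Polynomial.reflect N P, Polynomial.reflect N Q * Polynomial.X ^ 2, fun v hv => ?_,
      fun v hv => ?_⟩
    · obtain ⟨hv0, hvσ⟩ := hmem v hv
      have hQy : (Polynomial.aeval (inv Finset.univ v 0) Q : ℝ) ≠ 0 := hq _ hvσ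
      rw [hinv] at hQy
      have hrefl := soloInformed_aeval_reflect_K Q (N := N)
        (le_max_right P.natDegree Q.natDegree) (inv_ne_zero hv0)
      rw [_root_.inv_inv] at hrefl
      rw [map_mul, map_pow, Polynomial.aeval_X]
      refine mul_ne_zero (fun h => hQy ?_) (pow_ne_zero _ hv0)
      rw [← hrefl, h, zero_mul]
    · obtain ⟨hv0, hvσ⟩ := hmem v hv
      have hQy : (Polynomial.aeval (inv Finset.univ v 0) Q : ℝ) ≠ 0 := hq _ hvσ
      rw [hinv] at hQy
      have hP' := soloInformed_aeval_reflect_K P (N := N)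
        (le_max_left P.natDegree Q.natDegree) (inv_ne_zero hv0)
      have hQ' := soloInformed_aeval_reflect_K Q (N := N)
        (le_max_right P.natDegree Q.natDegree) (inv_ne_zero hv0)
      rw [_root_.inv_inv] at hP' hQ'
      rw [hint]
      show r.integrand (inv Finset.univ v) * |(invDeriv Finset.univ v).det| = _
      rw [hpq hvσ, hdet]
      show (Polynomial.aeval (inv Finset.univ v 0) P : ℝ) / Polynomial.aeval (inv Finset.univ v 0) Q
        * ((v 0) ^ 2)⁻¹ = (Polynomial.aeval (v 0) (Polynomial.reflect N P) : ℝ) /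
          Polynomial.aeval (v 0) (Polynomial.reflect N Q * Polynomial.X ^ 2)
      rw [hinv, map_mul, map_pow, Polynomial.aeval_X, ← hP', ← hQ']
      have hyN : ((v 0)⁻¹) ^ N ≠ 0 := pow_ne_zero _ (inv_ne_zero hv0)
      field_simp

/-- **Every member of the `K`-rational class of dimension `1` lies in the span of points and
segments** — no boundedness hypothesis (projective charts, then the bounded case of file 17).
[Viu-Sos 2021, Thm. 2.1; this work] -/
theorem soloInformed_segSpan_of_isKRationalOne (r : IntegralRep 1)
    (hr : SoloInformedIsKRationalOne r) : of r ∈ soloInformedSegSpan := by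
  obtain ⟨R, hR, hrel⟩ := soloInformed_exists_chartReps r
  exact soloInformed_mem_segSpan_of_sub_mem hrel (soloInformed_sum_mem_segSpan _ fun T _ =>
    soloInformed_segSpan_of_isKRationalOne_isBounded (R T)
      (soloInformed_isKRationalOne_chart r hr T (R T) (hR T).1 (hR T).2.1) (hR T).2.2)

/-- **The Kontsevich–Zagier period conjecture for rational integrands with real algebraic
coefficients in one variable** (unconditional, any `ℚ`-semialgebraic domain): two absolutely
convergent `∫_D N/M dx`, `∫_{D'} N'/M' dx` (`N, M, N', M'` real polynomials with real algebraic
coefficients, `M ≠ 0` on `D`, `M' ≠ 0` on `D'`) with the same value are connected by the three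
Kontsevich–Zagier moves; likewise against rational representations of dimension `≤ 1`.
[Kontsevich–Zagier 2001, §1.1 ("rational" → "algebraic") and §1.2 Question 1; this work] -/
theorem soloInformed_kzp_isKRationalOne (r r' : IntegralRep 1)
    (hr : SoloInformedIsKRationalOne r) (hr' : SoloInformedIsKRationalOne r') :
    (r.value = r'.value → Equivalent r r') ∧
      ∀ {n : ℕ} (hn : n ≤ 1) (r₀ : IntegralRep n), r₀.IsRational → r.value = r₀.value →
        Equivalent r r₀ :=
  ⟨fun hv => soloInformed_equivalent_of_mem_segSpan (soloInformed_segSpan_of_isKRationalOne r hr)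
      (soloInformed_segSpan_of_isKRationalOne r' hr') hv,
    fun hn r₀ hr₀ hv => soloInformed_equivalent_of_mem_segSpan
      (soloInformed_segSpan_of_isKRationalOne r hr)
      (soloInformed_of_mem_segSpan_of_isRational hn r₀ hr₀) hv⟩

/-- **Kernel form, `ℤ`-linear**: vanishing `ℤ`-combinations of values of members of the class are
relations. [this work] -/
theorem soloInformed_sum_zsmul_of_mem_relations_K' {ι : Type*} (s : Finset ι)
    (r : ι → IntegralRep 1) (c : ι → ℤ) (hr : ∀ i ∈ s, SoloInformedIsKRationalOne (r i))
    (h0 : ∑ i ∈ s, (c i : ℝ) * (r i).value = 0) :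
    ∑ i ∈ s, c i • of (r i) ∈ relations := by
  refine soloInformed_mem_relations_of_mem_segSpan
    (AddSubgroup.sum_mem _ fun i hi => AddSubgroup.zsmul_mem _
      (soloInformed_segSpan_of_isKRationalOne (r i) (hr i hi)) _) ?_
  rw [map_sum]
  simpa only [map_zsmul, eval_of, zsmul_eq_mul] using h0

/-- **Kernel form, `K`-linear**: real algebraic scalars `a_i`, members `r_i` of the class,
`Σ a_i · value(r_i) = 0` ⇒ `Σ [D_i, a_i f_i] ∈ relations`. [this work] -/
theorem soloInformed_sum_constMul_of_mem_relations_K' {ι : Type*} (s : Finset ι)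
    (r : ι → IntegralRep 1) (a : ι → ℝ) (ha : ∀ i, IsAlgebraic ℚ (a i))
    (hr : ∀ i ∈ s, SoloInformedIsKRationalOne (r i))
    (h0 : ∑ i ∈ s, a i * (r i).value = 0) :
    ∑ i ∈ s, of ((r i).constMul (a i) (ha i)) ∈ relations := by
  refine soloInformed_mem_relations_of_mem_segSpan
    (soloInformed_sum_mem_segSpan _ fun i hi => ?_) ?_
  · rw [← scale_of]
    exact soloInformed_scale_mem_segSpan (ha i) (soloInformed_segSpan_of_isKRationalOne (r i) (hr i hi))
  · rw [map_sum]
    simpa only [eval_of, IntegralRep.value_constMul] using h0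

/-- The equivalence form of membership in relations for differences inside the class. -/
theorem soloInformed_sub_mem_relations_iff_K (r r' : IntegralRep 1)
    (hr : SoloInformedIsKRationalOne r) (hr' : SoloInformedIsKRationalOne r') :
    of r - of r' ∈ relations ↔ r.value = r'.value := by
  refine ⟨fun h => ?_, fun hv => ?_⟩
  · have h0 : eval (of r - of r') = 0 := relations_le_ker_eval_holds h
    rw [map_sub, eval_of, eval_of] at h0
    exact sub_eq_zero.1 h0
  · refine soloInformed_mem_relations_of_mem_segSpan (sub_mem
      (soloInformed_segSpan_of_isKRationalOne r hr) (soloInformed_segSpan_of_isKRationalOne r' hr')) ?_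
    rw [map_sub, eval_of, eval_of, hv, sub_self]

end Summit.KontsevichZagierPeriods.KontsevichZagierPeriods.Theorems
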